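import Summits.Ventures.LatticeQCDFlow.Scoring.TorusFreeEnergyDensity2D
import Summits.Ventures.LatticeQCDFlow.Scoring.SUNOnePlaquetteBesselSeries
import HarnessLib

/-!
# The free energy density of two-dimensional `U(N)` and `SU(N)` lattice Yang–Mills on the torus, for EVERY `N`

HONEST FRAMING: exact (Metropolis-corrected) sampling algorithms for lattice gauge theory;
figures of merit are autocorrelation/cost numbers at stated couplings and volumes; no
continuum-physics claim.

Venture `LatticeQCDFlow` (cell pub-lqcd), sub-topic `Scoring`; FANOUT row 5 (`s0-sun-a`), GEN-17.
NEW WORK of the cell (placement rule).  GEN-16's `TorusFreeEnergyDensity2D` proved, for ANY compact group,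
that the 2-d torus free energy is `(L² − 1) log z₁(β) + O(1)` with density `log z₁(β)` (row 30's
two-dimensional independence of plaquettes), and read it for `SU(3)` given Weyl's formula.  With GEN-17's
closed forms of `z₁` for every `N` (`z1_unitary_eq_det`, `z1_specialUnitary_eq_tsum_det`, both on the Haar
measure, Weyl's formula now a theorem) this file states the result for ALL `N`:

* §1 **`U(N)`** (`N ≥ 0`): `z₁(β) = e^{−Nβ} det[I_{|i−j|}(β)]_{N×N}`, so for `β ≥ 0`, `L ≥ 2`,
  `(L²−1)F_N(β) − 2Nβ ≤ log Z^{U(N)}_{(ℤ/L)²}(β) ≤ (L²−1)F_N(β)` and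
  **`log Z^{U(N)}_{(ℤ/(L+2))²}(β)/(L+2)² → F_N(β) = −Nβ + log det[I_{|i−j|}(β)]_{N×N}`**;
* §2 **`SU(N)`** (`N ≥ 1`): the same with **`F_N(β) = −Nβ + log Σ_{q∈ℤ} det[I_{|q+i−j|}(β)]_{N×N}`**
  (GEN-16's `SU(3)` statement is the case `N = 3`, now unconditional).

No `def`, nothing cited as a fact, 0 sorry.
-/

noncomputable section

open Real MeasureTheory Filter Topology
open Literature.MathematicalPhysics.QuantumFieldTheory Literature.MathematicalPhysics.QuantumLattice
open Literature.Analysis.FunctionSpaces (besselI)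
open Literature.RepresentationTheory.CompactGroups
open Summit.Ventures.LatticeQCDFlow.Theory2.Lattice
open Summit.Ventures.LatticeQCDFlow.Theory2.Lattice.TwoDim

namespace Summit.Ventures.LatticeQCDFlow.Scoring

/-! ### 1. `U(N)` -/

/-- `Re tr U ≤ N` on `U(N)` (fundamental representation). -/
theorem unitary_trace_re_le (N : ℕ) (g : Matrix.unitaryGroup (Fin N) ℂ) :
    ((unitaryFundamentalRep (Fin N) ℂ g).trace).re ≤ (N : ℕ) := by
  have h := CompactGroup.abs_re_trace_le_card (unitaryFundamentalRep (Fin N) ℂ)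
    (continuous_unitaryFundamentalRep (Fin N) ℂ) g
  rw [Fintype.card_fin] at h
  exact (abs_le.mp h).2

/-- The `U(N)` plaquette action is at most `2N`: `N − Re tr U ≤ 2N`. -/
theorem unitary_plaqAction_le (N : ℕ) (g : Matrix.unitaryGroup (Fin N) ℂ) :
    ((N : ℕ) : ℝ) - ((unitaryFundamentalRep (Fin N) ℂ g).trace).re ≤ 2 * N := by
  have h := CompactGroup.abs_re_trace_le_card (unitaryFundamentalRep (Fin N) ℂ)
    (continuous_unitaryFundamentalRep (Fin N) ℂ) g
  rw [Fintype.card_fin] at h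
  have := (abs_le.mp h).1
  linarith

/-- **theory-2's `z₁^{U(N)}(β)` as a positive real**: `z₁(β).toReal = e^{−Nβ} det[I_{|i−j|}(β)]_{N×N}`. -/
theorem z1_unitary_toReal (N : ℕ) (β : ℝ) :
    (z1 (unitaryFundamentalRep (Fin N) ℂ) β).toReal
      = Real.exp (-(N * β)) * (Matrix.of fun i j : Fin N => besselI ((i : ℤ) - (j : ℤ)).natAbs β).det := by
  rw [z1_unitary_eq_det, ENNReal.toReal_ofReal]
  exact mul_nonneg (Real.exp_pos _).le (det_besselI_toeplitz_fin_pos N β).le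

/-- `log z₁^{U(N)}(β) = −Nβ + log det[I_{|i−j|}(β)]`. -/
theorem log_z1_unitary_toReal (N : ℕ) (β : ℝ) :
    Real.log (z1 (unitaryFundamentalRep (Fin N) ℂ) β).toReal
      = -(N * β) + Real.log (Matrix.of fun i j : Fin N => besselI ((i : ℤ) - (j : ℤ)).natAbs β).det := by
  rw [z1_unitary_toReal, Real.log_mul (Real.exp_pos _).ne' (det_besselI_toeplitz_fin_pos N β).ne', Real.log_exp]

/-- **THE 2-d `U(N)` TORUS FREE ENERGY IN BESSEL FORM, UP TO ONE PLAQUETTE** (every `N`): for `β ≥ 0`, `L ≥ 2`,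
with `F_N(β) = −Nβ + log det[I_{|i−j|}(β)]`, `(L² − 1) F_N(β) − 2Nβ ≤ log Z^{U(N)}_{(ℤ/L)²}(β) ≤ (L² − 1) F_N(β)`. -/
theorem log_partitionFunction_unitary_two_mem (N : ℕ) {L : ℕ} [NeZero L] (hL : 2 ≤ L) {β : ℝ} (hβ : 0 ≤ β) :
    ((L ^ 2 - 1 : ℕ) : ℝ) * (-(N * β) + Real.log (Matrix.of fun i j : Fin N =>
        besselI ((i : ℤ) - (j : ℤ)).natAbs β).det) - β * (2 * N)
        ≤ Real.log (partitionFunction (d := 2) (L := L) (unitaryFundamentalRep (Fin N) ℂ) β).toReal ∧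
      Real.log (partitionFunction (d := 2) (L := L) (unitaryFundamentalRep (Fin N) ℂ) β).toReal
        ≤ ((L ^ 2 - 1 : ℕ) : ℝ) * (-(N * β) + Real.log (Matrix.of fun i j : Fin N =>
          besselI ((i : ℤ) - (j : ℤ)).natAbs β).det) := by
  have h := log_partitionFunction_two_mem (unitaryFundamentalRep (Fin N) ℂ) hL
    (continuous_unitaryFundamentalRep (Fin N) ℂ) (unitary_trace_re_le N) (unitary_plaqAction_le N) hβ
  rw [log_z1_unitary_toReal] at h
  exact h

/-- **THE FREE ENERGY DENSITY OF 2-d `U(N)` LATTICE YANG–MILLS ON THE TORUS, EVERY `N`**: for `β ≥ 0`,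
`log Z^{U(N)}_{(ℤ/(L+2))²}(β) / (L+2)² → −Nβ + log det[I_{|i−j|}(β)]_{i,j<N}` as `L → ∞`. -/
theorem tendsto_log_partitionFunction_unitary_two_div_sq (N : ℕ) {β : ℝ} (hβ : 0 ≤ β) :
    Tendsto (fun L : ℕ =>
        Real.log (partitionFunction (d := 2) (L := L + 2) (unitaryFundamentalRep (Fin N) ℂ) β).toReal
          / ((((L + 2) ^ 2 : ℕ) : ℝ)))
      atTop (𝓝 (-(N * β) + Real.log (Matrix.of fun i j : Fin N => besselI ((i : ℤ) - (j : ℤ)).natAbs β).det)) := by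
  have h := tendsto_log_partitionFunction_two_div_sq (unitaryFundamentalRep (Fin N) ℂ)
    (continuous_unitaryFundamentalRep (Fin N) ℂ) (unitary_trace_re_le N) (unitary_plaqAction_le N) hβ
  rw [log_z1_unitary_toReal] at h
  exact h

/-! ### 2. `SU(N)`, `N ≥ 1` -/

/-- `Re tr U ≤ N` on `SU(N)` (fundamental representation). -/
theorem specialUnitary_trace_re_le (N : ℕ) (g : Matrix.specialUnitaryGroup (Fin N) ℂ) :
    ((fundamentalRep (Fin N) g).trace).re ≤ (N : ℕ) := by
  have h := CompactGroup.abs_re_trace_le_card (fundamentalRep (Fin N)) (continuous_fundamentalRep (Fin N)) g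
  rw [Fintype.card_fin] at h
  exact (abs_le.mp h).2

/-- The `SU(N)` plaquette action is at most `2N`. -/
theorem specialUnitary_plaqAction_le (N : ℕ) (g : Matrix.specialUnitaryGroup (Fin N) ℂ) :
    ((N : ℕ) : ℝ) - ((fundamentalRep (Fin N) g).trace).re ≤ 2 * N := by
  have h := CompactGroup.abs_re_trace_le_card (fundamentalRep (Fin N)) (continuous_fundamentalRep (Fin N)) g
  rw [Fintype.card_fin] at h
  have := (abs_le.mp h).1
  linarith

/-- **The Bars–Green series is positive**: `Σ_{q∈ℤ} det[I_{|q+i−j|}(x)]_{N×N} = ∫_{SU(N)} e^{x Re tr U} dU > 0` (`N ≥ 1`). -/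
theorem tsum_det_besselI_fin_pos (N : ℕ) [NeZero N] (x : ℝ) :
    0 < ∑' q : ℤ, (Matrix.of fun i j : Fin N => besselI (q + (i : ℤ) - (j : ℤ)).natAbs x).det := by
  rw [← integral_haar_specialUnitaryGroup_fin_exp_mul_trace_re]
  have hc : Continuous fun u : Matrix.specialUnitaryGroup (Fin N) ℂ =>
      Real.exp (x * ((u : Matrix.specialUnitaryGroup (Fin N) ℂ) : Matrix (Fin N) (Fin N) ℂ).trace.re) :=
    Real.continuous_exp.comp (continuous_const.mul (Complex.continuous_re.comp
      (continuous_id.matrix_trace.comp continuous_subtype_val)))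
  refine integral_exp_pos (Integrable.mono' (integrable_const (Real.exp (|x| * N))) hc.aestronglyMeasurable
    (Filter.Eventually.of_forall fun u => ?_))
  rw [Real.norm_of_nonneg (Real.exp_nonneg _)]
  refine Real.exp_le_exp.2 ((le_abs_self _).trans ?_)
  rw [abs_mul]
  refine mul_le_mul_of_nonneg_left ?_ (abs_nonneg _)
  have h := CompactGroup.abs_re_trace_le_card (fundamentalRep (Fin N)) (continuous_fundamentalRep (Fin N)) u
  rw [Fintype.card_fin, fundamentalRep_apply] at h
  exact h

/-- **theory-2's `z₁^{SU(N)}(β)` as a positive real** (`N ≥ 1`): `z₁(β).toReal = e^{−Nβ} Σ_q det[I_{|q+i−j|}(β)]`. -/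
theorem z1_specialUnitary_toReal (N : ℕ) [NeZero N] (β : ℝ) :
    (z1 (fundamentalRep (Fin N)) β).toReal
      = Real.exp (-(N * β)) * ∑' q : ℤ, (Matrix.of fun i j : Fin N => besselI (q + (i : ℤ) - (j : ℤ)).natAbs β).det := by
  rw [z1_specialUnitary_eq_tsum_det, ENNReal.toReal_ofReal]
  exact mul_nonneg (Real.exp_pos _).le (tsum_det_besselI_fin_pos N β).le

/-- `log z₁^{SU(N)}(β) = −Nβ + log Σ_q det[I_{|q+i−j|}(β)]` (`N ≥ 1`). -/
theorem log_z1_specialUnitary_toReal (N : ℕ) [NeZero N] (β : ℝ) :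
    Real.log (z1 (fundamentalRep (Fin N)) β).toReal
      = -(N * β) + Real.log (∑' q : ℤ, (Matrix.of fun i j : Fin N => besselI (q + (i : ℤ) - (j : ℤ)).natAbs β).det) := by
  rw [z1_specialUnitary_toReal, Real.log_mul (Real.exp_pos _).ne' (tsum_det_besselI_fin_pos N β).ne', Real.log_exp]

/-- **THE 2-d `SU(N)` TORUS FREE ENERGY IN BESSEL FORM, UP TO ONE PLAQUETTE** (`N ≥ 1`): for `β ≥ 0`, `L ≥ 2`,
with `F_N(β) = −Nβ + log Σ_q det[I_{|q+i−j|}(β)]`, `(L² − 1) F_N(β) − 2Nβ ≤ log Z^{SU(N)}_{(ℤ/L)²}(β) ≤ (L² − 1) F_N(β)`. -/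
theorem log_partitionFunction_specialUnitary_two_mem (N : ℕ) [NeZero N] {L : ℕ} [NeZero L] (hL : 2 ≤ L)
    {β : ℝ} (hβ : 0 ≤ β) :
    ((L ^ 2 - 1 : ℕ) : ℝ) * (-(N * β) + Real.log (∑' q : ℤ, (Matrix.of fun i j : Fin N =>
        besselI (q + (i : ℤ) - (j : ℤ)).natAbs β).det)) - β * (2 * N)
        ≤ Real.log (partitionFunction (d := 2) (L := L) (fundamentalRep (Fin N)) β).toReal ∧
      Real.log (partitionFunction (d := 2) (L := L) (fundamentalRep (Fin N)) β).toReal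
        ≤ ((L ^ 2 - 1 : ℕ) : ℝ) * (-(N * β) + Real.log (∑' q : ℤ, (Matrix.of fun i j : Fin N =>
          besselI (q + (i : ℤ) - (j : ℤ)).natAbs β).det)) := by
  have h := log_partitionFunction_two_mem (fundamentalRep (Fin N)) hL
    (continuous_fundamentalRep (Fin N)) (specialUnitary_trace_re_le N) (specialUnitary_plaqAction_le N) hβ
  rw [log_z1_specialUnitary_toReal] at h
  exact h

/-- **THE FREE ENERGY DENSITY OF 2-d `SU(N)` LATTICE YANG–MILLS ON THE TORUS, EVERY `N ≥ 1`**: for `β ≥ 0`,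
`log Z^{SU(N)}_{(ℤ/(L+2))²}(β) / (L+2)² → −Nβ + log Σ_{q∈ℤ} det[I_{|q+i−j|}(β)]_{i,j<N}` as `L → ∞`. -/
theorem tendsto_log_partitionFunction_specialUnitary_two_div_sq (N : ℕ) [NeZero N] {β : ℝ} (hβ : 0 ≤ β) :
    Tendsto (fun L : ℕ =>
        Real.log (partitionFunction (d := 2) (L := L + 2) (fundamentalRep (Fin N)) β).toReal
          / ((((L + 2) ^ 2 : ℕ) : ℝ)))
      atTop (𝓝 (-(N * β) + Real.log (∑' q : ℤ, (Matrix.of fun i j : Fin N =>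
        besselI (q + (i : ℤ) - (j : ℤ)).natAbs β).det))) := by
  have h := tendsto_log_partitionFunction_two_div_sq (fundamentalRep (Fin N))
    (continuous_fundamentalRep (Fin N)) (specialUnitary_trace_re_le N) (specialUnitary_plaqAction_le N) hβ
  rw [log_z1_specialUnitary_toReal] at h
  exact h

end Summit.Ventures.LatticeQCDFlow.Scoring
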